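import Summits.CriticalPhenomena.Ising3DConformalLimit.Theorems.IsingEuclidUpgradeR4NonGaussianDefs
import Literature.Probability.LatticeModels.IntersectionSecondMoment
import Literature.Probability.LatticeModels.CurrentsPartialMonotonicity
import Literature.Probability.LatticeModels.SourcedDoubleCurrentsSwitching
import HarnessLib

/-!
# Crux `IsingEuclidUpgradeR4NonGaussian` (stmt-CriticalPhenomena-0636), line
# `free-covariance-delta-dichotomy`: registered stub `stub_secondMomentBox`
# (Aizenman–Duminil-Copin 2021, Lemma 4.4: the second-moment inequality, disjoint source pairs)

In the free box `Λ_L ⊂ ℤ³` at `β_c(3)`, for `a, b, c, e ∈ Λ_L` and `A ⊆ Λ_L`: `M₁²/M₂ ≤ P⁴`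
(`boxMoment₁`, `boxMoment₂`, `fourCurrentMeet` of the Defs module) — the step `P[N ≠ 0] ≥ E[N]²/E[N²]`
of M. Aizenman, H. Duminil-Copin, Ann. of Math. **194** (2021) = arXiv:1912.07973, §4.2, proof of
Lemma 4.4, for the number `N` of sites of `A` in `C_{n₁+n₃}(a) ∩ C_{n₂+n₄}(c)` under two INDEPENDENT
sourced double currents with DISJOINT source pairs `{a,b}`, `{c,e}` (the tree's
`IntersectionSecondMoment.lean` is the printed shared-source version). §1: the un-normalised steps on any
finite graph (first moment by switching, second moment by ADC Prop. A.3, Cauchy–Schwarz,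
`{N ≠ 0} ⊆ {a ↔ c in the sum of the four currents}`); §2: transport — `P^{A,∅}_{Λ_L}{p} = w(p)/(Z[A]Z[∅])`,
product measures of sets on countable discrete spaces are series of products of singleton masses,
`G_L(x,y) = Z[xy]/Z[∅]` (`isingTwoPoint_free_box_eq_boxGraph`, `isingTwoPoint_free_eq_currentSum_div_holds`),
so `M₁ = E⁴[N]`, `M₂ ≥ E⁴[N²]`, `P⁴ = (∑ W 𝟙[MEET₄])/(Z[ab]Z[∅]Z[ce]Z[∅])`; degenerate cases by `x/0 = 0`.
Everything is proved; no definition and no named fact is introduced. Reference: ADC21 §3.1–3.2, §4.2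
(Lemma 4.4), App. A.2 (Prop. A.3) [AizenmanDuminilCopinAnnals2021].
-/

noncomputable section

open Filter Topology Set Function MeasureTheory Finset
open Literature.Probability.LatticeModels Literature.Probability.Percolation
open scoped symmDiff ENNReal

namespace Summit.CriticalPhenomena.Ising3DConformalLimit.Cruxes.IsingEuclidUpgradeR4NonGaussian.FreeCovarianceDeltaDichotomy

/-! ## §1. The un-normalised second-moment steps for DISJOINT source pairs -/

section Unnormalised

variable {V : Type*} [Fintype V] [DecidableEq V] {G : SimpleGraph V} [DecidableRel G.Adj]
  {K : G.edgeFinset → ℝ}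

open Current

/-- Fubini for the disjoint-pair product weight against a product function. [folklore] -/
private theorem tsum_pairProd_mul_mul (K : G.edgeFinset → ℝ) (a b c e : V)
    (f g : Current G × Current G → ℝ≥0∞) :
    ∑' pq : (Current G × Current G) × (Current G × Current G),
        epairWeight K ({a} ∆ {b}) ∅ pq.1 * epairWeight K ({c} ∆ {e}) ∅ pq.2 * (f pq.1 * g pq.2) =
      (∑' p, epairWeight K ({a} ∆ {b}) ∅ p * f p) * ∑' q, epairWeight K ({c} ∆ {e}) ∅ q * g q := by
  rw [tsum_mul_tsum_eq_tsum_prod]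
  exact tsum_congr fun pq => by ring

/-- First moment of the intersection count of `C_{n₁+n₃}(a)` and `C_{n₂+n₄}(c)` in `A`, un-normalised
(disjoint source pairs): `∑ W N = ∑_{v ∈ A} (Z[bv] Z[av]) · (Z[ev] Z[cv])`.
[cite: AizenmanDuminilCopinAnnals2021, §4.2, proof of Lemma 4.4 (first moment of |𝓜|)] -/
private theorem tsum_pairProd_mul_count (hK : ∀ e, 0 ≤ K e) (A : Finset V) (a b c e : V) :
    ∑' pq : (Current G × Current G) × (Current G × Current G),
        epairWeight K ({a} ∆ {b}) ∅ pq.1 * epairWeight K ({c} ∆ {e}) ∅ pq.2 *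
          (∑ v ∈ A, connInd v a pq.1 * connInd v c pq.2) =
      ∑ v ∈ A, (ecurrentSum K ({b} ∆ {v}) * ecurrentSum K ({a} ∆ {v})) *
        (ecurrentSum K ({e} ∆ {v}) * ecurrentSum K ({c} ∆ {v})) := by
  simp_rw [Finset.mul_sum]
  rw [Summable.tsum_finsetSum (fun _ _ => ENNReal.summable)]
  refine Finset.sum_congr rfl fun v _ => ?_
  rw [tsum_pairProd_mul_mul K a b c e (connInd v a) (connInd v c)]
  unfold connInd
  rw [tsum_epairWeight_mul_indicator_mem_cluster hK a b v,
    tsum_epairWeight_mul_indicator_mem_cluster hK c e v]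

/-- Second moment of the intersection count, un-normalised (Proposition A.3 twice):
`Z[∅]² ∑ W N² ≤ ∑_{v,w ∈ A} B_{ab}(v,w) B_{ce}(v,w)`.
[cite: AizenmanDuminilCopinAnnals2021, §4.2, proof of Lemma 4.4 (second moment of |𝓜|)] -/
private theorem sq_mul_tsum_pairProd_mul_count_sq_le (hK : ∀ e, 0 ≤ K e) (A : Finset V)
    (a b c e : V) :
    ecurrentSum K ∅ ^ 2 *
        ∑' pq : (Current G × Current G) × (Current G × Current G),
          epairWeight K ({a} ∆ {b}) ∅ pq.1 * epairWeight K ({c} ∆ {e}) ∅ pq.2 *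
            (∑ v ∈ A, connInd v a pq.1 * connInd v c pq.2) ^ 2 ≤
      ∑ v ∈ A, ∑ w ∈ A, twoStepBound K a b v w * twoStepBound K c e v w := by
  have hexp : ∀ pq : (Current G × Current G) × (Current G × Current G),
      epairWeight K ({a} ∆ {b}) ∅ pq.1 * epairWeight K ({c} ∆ {e}) ∅ pq.2 *
          (∑ v ∈ A, connInd v a pq.1 * connInd v c pq.2) ^ 2 =
        ∑ v ∈ A, ∑ w ∈ A, epairWeight K ({a} ∆ {b}) ∅ pq.1 * epairWeight K ({c} ∆ {e}) ∅ pq.2 *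
          ((connInd v a pq.1 * connInd w a pq.1) * (connInd v c pq.2 * connInd w c pq.2)) := by
    intro pq
    rw [sq, Finset.sum_mul_sum, Finset.mul_sum]
    refine Finset.sum_congr rfl fun v _ => ?_
    rw [Finset.mul_sum]
    exact Finset.sum_congr rfl fun w _ => by ring
  rw [tsum_congr hexp, Summable.tsum_finsetSum (fun _ _ => ENNReal.summable), Finset.mul_sum]
  refine Finset.sum_le_sum fun v _ => ?_
  rw [Summable.tsum_finsetSum (fun _ _ => ENNReal.summable), Finset.mul_sum]
  refine Finset.sum_le_sum fun w _ => ?_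
  rw [tsum_pairProd_mul_mul K a b c e (fun p => connInd v a p * connInd w a p)
    (fun q => connInd v c q * connInd w c q)]
  calc ecurrentSum K ∅ ^ 2 *
        ((∑' p, epairWeight K ({a} ∆ {b}) ∅ p * (connInd v a p * connInd w a p)) *
          ∑' q, epairWeight K ({c} ∆ {e}) ∅ q * (connInd v c q * connInd w c q))
      = (ecurrentSum K ∅ * ∑' p, epairWeight K ({a} ∆ {b}) ∅ p * (connInd v a p * connInd w a p)) *
          (ecurrentSum K ∅ *
            ∑' q, epairWeight K ({c} ∆ {e}) ∅ q * (connInd v c q * connInd w c q)) := by ring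
    _ ≤ twoStepBound K a b v w * twoStepBound K c e v w :=
        mul_le_mul' (ecurrentSum_empty_mul_tsum_connInd_mul_connInd_le hK a b v w)
          (ecurrentSum_empty_mul_tsum_connInd_mul_connInd_le hK c e v w)

/-- If the two clusters share a vertex of `A`, then `c ∈ C(a)` for the sum of all four currents.
[folklore] -/
private theorem reachable_of_count_ne_zero (A : Finset V) (a c : V)
    (pq : (Current G × Current G) × (Current G × Current G))
    (h : (∑ v ∈ A, connInd v a pq.1 * connInd v c pq.2) ≠ 0) :
    c ∈ ((pq.1.1 + pq.1.2) + (pq.2.1 + pq.2.2)).cluster a := by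
  obtain ⟨v, -, hv⟩ := Finset.exists_ne_zero_of_sum_ne_zero h
  unfold connInd at hv
  have hva : v ∈ (pq.1.1 + pq.1.2).cluster a := by
    by_contra h'; exact hv (by rw [if_neg h', zero_mul])
  have hvc : v ∈ (pq.2.1 + pq.2.2).cluster c := by
    by_contra h'; exact hv (by rw [if_neg h', mul_zero])
  exact mem_cluster_trans (cluster_mono (self_le_add_right _ _) a hva)
    (mem_cluster_comm.1 (cluster_mono (self_le_add_left _ _) c hvc))

end Unnormalised

/-! ## §2a. Product measures on countable discrete spaces; singleton masses of `doubleCurrentMeasure` -/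

/-- The product measure of a set on countable discrete spaces, as a series over points. [folklore] -/
private theorem prod_apply_eq_tsum {α γ : Type*} [MeasurableSpace α] [MeasurableSpace γ]
    [Countable α] [Countable γ] [MeasurableSingletonClass α] [MeasurableSingletonClass γ]
    (μ : Measure α) (ν : Measure γ) [SFinite ν] (S : Set (α × γ)) :
    μ.prod ν S = ∑' pq : α × γ, μ {pq.1} * ν {pq.2} * S.indicator 1 pq := by
  classical
  have hS : MeasurableSet S := S.to_countable.measurableSet
  rw [Measure.prod_apply hS, lintegral_countable', ENNReal.tsum_prod']
  refine tsum_congr fun p => ?_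
  rw [← Measure.tsum_indicator_apply_singleton ν (Prod.mk p ⁻¹' S)
    (Set.to_countable _).measurableSet, ← ENNReal.tsum_mul_right]
  refine tsum_congr fun q => ?_
  by_cases h : (p, q) ∈ S
  · rw [Set.indicator_of_mem (show q ∈ Prod.mk p ⁻¹' S from h), Set.indicator_of_mem h,
      Pi.one_apply, mul_one, mul_comm]
  · rw [Set.indicator_of_notMem (show q ∉ Prod.mk p ⁻¹' S from h), Set.indicator_of_notMem h,
      mul_zero, zero_mul]

section DCM

variable {V : Type*} [Fintype V] [DecidableEq V] (G : SimpleGraph V) [DecidableRel G.Adj]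

/-- The tree's real pair weight, cast to `ℝ≥0∞`, is the `ℝ≥0∞` pair weight of the constant coupling.
[folklore] -/
private theorem ofReal_pairWeight_eq_epairWeight (β : ℝ) (hβ : 0 ≤ β) (A B : Finset V)
    (p : Current G × Current G) :
    ENNReal.ofReal (pairWeight G β A B p) = epairWeight (fun _ : G.edgeFinset => β) A B p := by
  unfold pairWeight epairWeight Current.eweight
  split_ifs with h
  · rw [ENNReal.ofReal_mul (Current.weight_nonneg hβ _)]
    rfl
  · exact ENNReal.ofReal_zero

/-- The singleton masses of the double-current measure, `P^{A,B}{p} = w_{A,B}(p)/(Z[A] Z[B])` in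
`ℝ≥0∞`, when currents with the prescribed sources exist. [folklore] -/
private theorem doubleCurrentMeasure_singleton (β : ℝ) (hβ : 0 ≤ β) (A B : Finset V)
    (hA : currentSum G β A ≠ 0) (hB : currentSum G β B ≠ 0) (p : Current G × Current G) :
    doubleCurrentMeasure G β A B {p} =
      epairWeight (fun _ : G.edgeFinset => β) A B p /
        (ecurrentSum (fun _ : G.edgeFinset => β) A * ecurrentSum (fun _ : G.edgeFinset => β) B) := by
  have hZ : 0 < currentSum G β A * currentSum G β B :=
    mul_pos (lt_of_le_of_ne (currentSum_nonneg G hβ A) (Ne.symm hA))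
      (lt_of_le_of_ne (currentSum_nonneg G hβ B) (Ne.symm hB))
  rw [doubleCurrentMeasure, Measure.sum_apply _ (measurableSet_singleton p)]
  simp only [Measure.smul_apply, smul_eq_mul, Measure.dirac_apply, Set.indicator_apply,
    Set.mem_singleton_iff, Pi.one_apply, mul_ite, mul_one, mul_zero]
  rw [tsum_ite_eq, ENNReal.ofReal_div_of_pos hZ, ENNReal.ofReal_mul (currentSum_nonneg G hβ A),
    ofReal_pairWeight_eq_epairWeight G β hβ, currentSum_eq_wcurrentSum, currentSum_eq_wcurrentSum,
    ← ecurrentSum_eq_ofReal (fun _ => hβ), ← ecurrentSum_eq_ofReal (fun _ => hβ)]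

end DCM

/-! ## §2b. Transport to the free box `Λ_L ⊂ ℤ³` at `β_c(3)` -/

section Box

/-- The free box two-point function at `β_c` as a ratio of `ℝ≥0∞` current sums of the free box graph,
`G_L(x,y) = Z[{x}∆{y}]/Z[∅]` (random-current representation). [folklore] -/
private theorem boxG_eq_div (L : ℕ) (x y : BoxVertex 3 L) (hx : (x : Site 3) ∈ box 3 L)
    (hy : (y : Site 3) ∈ box 3 L) :
    boxG L x y =
      (ecurrentSum (fun _ : (freeBoxGraph 3 L).edgeFinset => criticalBeta 3) ({x} ∆ {y})).toReal /
        (ecurrentSum (fun _ : (freeBoxGraph 3 L).edgeFinset => criticalBeta 3) ∅).toReal := by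
  have hK : ∀ e : (freeBoxGraph 3 L).edgeFinset,
      0 ≤ (fun _ : (freeBoxGraph 3 L).edgeFinset => criticalBeta 3) e :=
    fun _ => criticalBeta_nonneg 3
  rw [boxG, isingTwoPoint_free_box_eq_boxGraph 3 L _ x y hx hy,
    isingTwoPoint_free_eq_currentSum_div_holds (freeBoxGraph 3 L) (criticalBeta 3) x y,
    currentSum_eq_wcurrentSum, currentSum_eq_wcurrentSum, toReal_ecurrentSum hK, toReal_ecurrentSum hK]

/-- Membership in `FourMeet` for box vertices: `c ∈ C_{n₁+n₃+n₂+n₄}(a)`. [folklore] -/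
private theorem mem_fourMeet_iff (L : ℕ) (a c : BoxVertex 3 L)
    (pq : (Current (freeBoxGraph 3 L) × Current (freeBoxGraph 3 L)) ×
      (Current (freeBoxGraph 3 L) × Current (freeBoxGraph 3 L))) :
    pq ∈ FourMeet L a c ↔ c ∈ ((pq.1.1 + pq.1.2) + (pq.2.1 + pq.2.2)).cluster a := by
  rw [FourMeet, Set.mem_setOf_eq, liftBonds_mem_openConn_iff 3 _ a c, Current.mem_cluster_iff]
  rfl

/-- **The second-moment inequality in the free box, cross-multiplied** (Aizenman–Duminil-Copin 2021,
Lemma 4.4 with disjoint source pairs): for box vertices `a, b, c, e ∈ Λ_L` with `G_L(a,b) ≠ 0`,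
`G_L(c,e) ≠ 0` and `A ⊆ Λ_L`, `M₁² ≤ P⁴ · M₂`.
[cite: AizenmanDuminilCopinAnnals2021, §4.2, proof of Lemma 4.4] -/
private theorem boxMoment₁_sq_le (L : ℕ) (a b c e : BoxVertex 3 L) (ha : (a : Site 3) ∈ box 3 L)
    (hb : (b : Site 3) ∈ box 3 L) (hc : (c : Site 3) ∈ box 3 L) (he : (e : Site 3) ∈ box 3 L)
    (A : Finset (Site 3)) (hA : A ⊆ box 3 L) (hab : boxG L a b ≠ 0) (hce : boxG L c e ≠ 0) :
    boxMoment₁ L a b c e A ^ 2 ≤ fourCurrentMeet L a b c e * boxMoment₂ L a b c e A := by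
  classical
  have hβ : 0 ≤ criticalBeta 3 := criticalBeta_nonneg 3
  set K : (freeBoxGraph 3 L).edgeFinset → ℝ := fun _ => criticalBeta 3 with hKdef
  have hK : ∀ e', 0 ≤ K e' := fun _ => hβ
  set Z : Finset (BoxVertex 3 L) → ℝ≥0∞ := ecurrentSum K with hZdef
  have hZtop : ∀ S, Z S ≠ ∞ := fun S => ecurrentSum_ne_top hK S
  have hZ0 : Z ∅ ≠ 0 := ecurrentSum_empty_ne_zero K
  -- the box two-point functions as ratios; nondegeneracy; positivity of the partition functions
  have hG : ∀ x y : BoxVertex 3 L, (x : Site 3) ∈ box 3 L → (y : Site 3) ∈ box 3 L →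
      boxG L x y = (Z ({x} ∆ {y})).toReal / (Z ∅).toReal :=
    fun x y hx hy => boxG_eq_div L x y hx hy
  have hZab : Z ({a} ∆ {b}) ≠ 0 := fun h =>
    hab (by rw [hG a b ha hb, h, ENNReal.toReal_zero, zero_div])
  have hZce : Z ({c} ∆ {e}) ≠ 0 := fun h =>
    hce (by rw [hG c e hc he, h, ENNReal.toReal_zero, zero_div])
  have hr0 : 0 < (Z ∅).toReal := ENNReal.toReal_pos hZ0 (hZtop _)
  have hrab : 0 < (Z ({a} ∆ {b})).toReal := ENNReal.toReal_pos hZab (hZtop _)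
  have hrce : 0 < (Z ({c} ∆ {e})).toReal := ENNReal.toReal_pos hZce (hZtop _)
  have hcs : ∀ S, Z S ≠ 0 → currentSum (freeBoxGraph 3 L) (criticalBeta 3) S ≠ 0 := fun S hS => by
    rw [currentSum_eq_wcurrentSum, ← toReal_ecurrentSum hK]
    exact (ENNReal.toReal_pos hS (hZtop S)).ne'
  obtain ⟨hr0', hrab', hrce'⟩ := And.intro hr0.ne' (And.intro hrab.ne' hrce.ne')
  -- the normaliser `R = Z[ab] Z[∅] Z[ce] Z[∅]` (real)
  set R : ℝ := (Z ({a} ∆ {b})).toReal * (Z ∅).toReal * ((Z ({c} ∆ {e})).toReal * (Z ∅).toReal)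
    with hRdef
  have hRpos : 0 < R := mul_pos (mul_pos hrab hr0) (mul_pos hrce hr0)
  -- sums over `A` as sums over box vertices
  set A' : Finset (BoxVertex 3 L) := boxSources 3 L A with hA'def
  have hsumA : ∀ f : Site 3 → ℝ, ∑ v ∈ A, f v = ∑ v ∈ A', f (v : Site 3) := fun f => by
    conv_lhs => rw [← map_boxEmb_boxSources 3 (hA.trans (box_subset_box_succ 3 L))]
    rw [Finset.sum_map]
    rfl
  have hA'box : ∀ v ∈ A', (v : Site 3) ∈ box 3 L := fun v hv => hA (mem_boxSources_iff.1 hv)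
  -- the un-normalised weight `W` of `P^{ab,∅} ⊗ P^{ce,∅}` and the intersection count `N`
  set W : (Current (freeBoxGraph 3 L) × Current (freeBoxGraph 3 L)) ×
      (Current (freeBoxGraph 3 L) × Current (freeBoxGraph 3 L)) → ℝ≥0∞ :=
    fun pq => epairWeight K ({a} ∆ {b}) ∅ pq.1 * epairWeight K ({c} ∆ {e}) ∅ pq.2 with hWdef
  set N : (Current (freeBoxGraph 3 L) × Current (freeBoxGraph 3 L)) ×
      (Current (freeBoxGraph 3 L) × Current (freeBoxGraph 3 L)) → ℝ≥0∞ :=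
    fun pq => ∑ v ∈ A', Current.connInd v a pq.1 * Current.connInd v c pq.2 with hNdef
  -- §1: (i) first moment, (iv) `{N ≠ 0} ⊆ MEET₄`, and the chain (iii) Cauchy–Schwarz + (ii) Prop. A.3
  have h1 : ∑' pq, W pq * N pq =
      ∑ v ∈ A', (Z ({b} ∆ {v}) * Z ({a} ∆ {v})) * (Z ({e} ∆ {v}) * Z ({c} ∆ {v})) :=
    tsum_pairProd_mul_count hK A' a b c e
  have h4 : ∀ pq, (if N pq = 0 then (0 : ℝ≥0∞) else 1) ≤ (FourMeet L a c).indicator 1 pq := by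
    intro pq
    by_cases hN : N pq = 0
    · rw [if_pos hN]; exact bot_le
    · rw [if_neg hN, Set.indicator_of_mem ((mem_fourMeet_iff L a c pq).2
        (reachable_of_count_ne_zero A' a c pq hN)), Pi.one_apply]
  have hchain : (∑' pq, W pq * N pq) ^ 2 * Z ∅ ^ 2 ≤
      (∑' pq, W pq * (FourMeet L a c).indicator 1 pq) *
        ∑ v ∈ A', ∑ w ∈ A', Current.twoStepBound K a b v w * Current.twoStepBound K c e v w :=
    calc (∑' pq, W pq * N pq) ^ 2 * Z ∅ ^ 2
        ≤ ((∑' pq, W pq * (if N pq = 0 then 0 else 1)) * ∑' pq, W pq * N pq ^ 2) * Z ∅ ^ 2 :=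
          mul_le_mul' (Current.tsum_mul_sq_le_tsum_indicator_mul_tsum_sq W N) le_rfl
      _ = (∑' pq, W pq * (if N pq = 0 then 0 else 1)) * (Z ∅ ^ 2 * ∑' pq, W pq * N pq ^ 2) := by
          ring
      _ ≤ _ := mul_le_mul' (ENNReal.tsum_le_tsum fun pq => mul_le_mul' le_rfl (h4 pq))
          (sq_mul_tsum_pairProd_mul_count_sq_le hK A' a b c e)
  -- finiteness, and the real form of the chain
  have hWsum : ∑' pq, W pq = Z ({a} ∆ {b}) * Z ∅ * (Z ({c} ∆ {e}) * Z ∅) := by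
    rw [hZdef, ← tsum_epairWeight, ← tsum_epairWeight, tsum_mul_tsum_eq_tsum_prod]
  have hZt : Z ({a} ∆ {b}) * Z ∅ * (Z ({c} ∆ {e}) * Z ∅) ≠ ∞ :=
    ENNReal.mul_ne_top (ENNReal.mul_ne_top (hZtop _) (hZtop _))
      (ENNReal.mul_ne_top (hZtop _) (hZtop _))
  have hT0top : (∑' pq, W pq * (FourMeet L a c).indicator 1 pq) ≠ ∞ := by
    refine ne_top_of_le_ne_top hZt ?_
    rw [← hWsum]
    exact ENNReal.tsum_le_tsum fun pq => mul_le_of_le_one_right' (Set.indicator_le_self _ _ pq)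
  have htsb : ∀ o x v w : BoxVertex 3 L, Current.twoStepBound K o x v w ≠ ∞ := fun o x v w =>
    ENNReal.add_ne_top.2
      ⟨ENNReal.mul_ne_top (ENNReal.mul_ne_top (hZtop _) (hZtop _)) (hZtop _),
        ENNReal.mul_ne_top (ENNReal.mul_ne_top (hZtop _) (hZtop _)) (hZtop _)⟩
  have hBBtop : ∀ v ∈ A', ∑ w ∈ A', Current.twoStepBound K a b v w * Current.twoStepBound K c e v w ≠
      ∞ := fun v _ => ENNReal.sum_ne_top.2 fun w _ => ENNReal.mul_ne_top (htsb _ _ _ _) (htsb _ _ _ _)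
  have hreal : (∑' pq, W pq * N pq).toReal ^ 2 * (Z ∅).toReal ^ 2 ≤
      (∑' pq, W pq * (FourMeet L a c).indicator 1 pq).toReal *
        (∑ v ∈ A', ∑ w ∈ A', Current.twoStepBound K a b v w * Current.twoStepBound K c e v w).toReal :=
    by
    rw [← ENNReal.toReal_pow, ← ENNReal.toReal_pow, ← ENNReal.toReal_mul, ← ENNReal.toReal_mul]
    exact ENNReal.toReal_mono (ENNReal.mul_ne_top hT0top (ENNReal.sum_ne_top.2 hBBtop)) hchain
  -- §2: the four-current law, `P⁴ · R = (∑ W 𝟙[MEET₄]).toReal`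
  haveI : IsProbabilityMeasure
      (doubleCurrentMeasure (freeBoxGraph 3 L) (criticalBeta 3) ({a} ∆ {b}) ∅) :=
    isProbabilityMeasure_doubleCurrentMeasure_holds _ hβ (hcs _ hZab) (hcs _ hZ0)
  haveI : IsProbabilityMeasure
      (doubleCurrentMeasure (freeBoxGraph 3 L) (criticalBeta 3) ({c} ∆ {e}) ∅) :=
    isProbabilityMeasure_doubleCurrentMeasure_holds _ hβ (hcs _ hZce) (hcs _ hZ0)
  have hP4 : fourCurrentLaw L a b c e (FourMeet L a c) =
      (∑' pq, W pq * (FourMeet L a c).indicator 1 pq) /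
        (Z ({a} ∆ {b}) * Z ∅ * (Z ({c} ∆ {e}) * Z ∅)) := by
    rw [fourCurrentLaw, boxSources_pair, boxSources_pair, prod_apply_eq_tsum, div_eq_mul_inv,
      ← ENNReal.tsum_mul_right]
    refine tsum_congr fun pq => ?_
    rw [doubleCurrentMeasure_singleton _ _ hβ _ _ (hcs _ hZab) (hcs _ hZ0),
      doubleCurrentMeasure_singleton _ _ hβ _ _ (hcs _ hZce) (hcs _ hZ0),
      ENNReal.mul_inv (Or.inl (mul_ne_zero hZab hZ0))
        (Or.inl (ENNReal.mul_ne_top (hZtop _) (hZtop _))), div_eq_mul_inv, div_eq_mul_inv]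
    ring
  have hP4r : fourCurrentMeet L a b c e * R =
      (∑' pq, W pq * (FourMeet L a c).indicator 1 pq).toReal := by
    rw [fourCurrentMeet, measureReal_def, hP4, ENNReal.toReal_div, ENNReal.toReal_mul,
      ENNReal.toReal_mul, ENNReal.toReal_mul]
    exact div_mul_cancel₀ _ hRpos.ne'
  -- §2: `M₁ · R = (∑ W N).toReal` and `M₂ · Z[∅]² R = (∑∑ B_{ab} B_{ce}).toReal`
  have hM1 : boxMoment₁ L a b c e A * R = (∑' pq, W pq * N pq).toReal := by
    rw [h1, ENNReal.toReal_sum (fun v _ => ENNReal.mul_ne_top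
      (ENNReal.mul_ne_top (hZtop _) (hZtop _)) (ENNReal.mul_ne_top (hZtop _) (hZtop _))),
      boxMoment₁, hsumA, Finset.sum_mul]
    refine Finset.sum_congr rfl fun v hv => ?_
    have hvb := hA'box v hv
    rw [ENNReal.toReal_mul, ENNReal.toReal_mul, ENNReal.toReal_mul, threePointRatio,
      threePointRatio, hG a v ha hvb, hG v b hvb hb, hG a b ha hb, hG c v hc hvb, hG v e hvb he,
      hG c e hc he, symmDiff_comm ({v} : Finset (BoxVertex 3 L)) {b},
      symmDiff_comm ({v} : Finset (BoxVertex 3 L)) {e}]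
    field_simp
    rw [hRdef]
    ring
  have hM2 : boxMoment₂ L a b c e A * ((Z ∅).toReal ^ 2 * R) =
      (∑ v ∈ A', ∑ w ∈ A', Current.twoStepBound K a b v w * Current.twoStepBound K c e v w).toReal :=
    by
    rw [ENNReal.toReal_sum hBBtop, boxMoment₂, hsumA, Finset.sum_mul]
    refine Finset.sum_congr rfl fun v hv => ?_
    have hvb := hA'box v hv
    rw [ENNReal.toReal_sum (fun w _ => ENNReal.mul_ne_top (htsb _ _ _ _) (htsb _ _ _ _)), hsumA,
      Finset.sum_mul]
    refine Finset.sum_congr rfl fun w hw => ?_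
    have hwb := hA'box w hw
    have h3top : ∀ s t u : Finset (BoxVertex 3 L), Z s * Z t * Z u ≠ ∞ := fun s t u =>
      ENNReal.mul_ne_top (ENNReal.mul_ne_top (hZtop _) (hZtop _)) (hZtop _)
    rw [ENNReal.toReal_mul, Current.twoStepBound, Current.twoStepBound,
      ENNReal.toReal_add (h3top _ _ _) (h3top _ _ _), ENNReal.toReal_add (h3top _ _ _) (h3top _ _ _)]
    simp only [ENNReal.toReal_mul]
    rw [twoStep, twoStep, hG a v ha hvb, hG v w hvb hwb, hG w b hwb hb, hG a w ha hwb, hG w v hwb hvb,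
      hG v b hvb hb, hG a b ha hb, hG c v hc hvb, hG w e hwb he, hG c w hc hwb, hG v e hvb he,
      hG c e hc he]
    field_simp
    rw [hRdef]
    ring
  -- conclusion: clear the positive factor `Z[∅]² R²`
  refine le_of_mul_le_mul_right ?_ (mul_pos (pow_pos hr0 2) (pow_pos hRpos 2))
  calc boxMoment₁ L a b c e A ^ 2 * ((Z ∅).toReal ^ 2 * R ^ 2)
      = (boxMoment₁ L a b c e A * R) ^ 2 * (Z ∅).toReal ^ 2 := by ring
    _ ≤ (fourCurrentMeet L a b c e * R) * (boxMoment₂ L a b c e A * ((Z ∅).toReal ^ 2 * R)) := by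
        rw [hM1, hP4r, hM2]; exact hreal
    _ = fourCurrentMeet L a b c e * boxMoment₂ L a b c e A * ((Z ∅).toReal ^ 2 * R ^ 2) := by ring

end Box

/-! ## §3. The registered stub -/

/-- **Registered stub `stub_secondMomentBox`** (line `free-covariance-delta-dichotomy` of crux
stmt-CriticalPhenomena-0636; Aizenman–Duminil-Copin 2021, Lemma 4.4, second-moment step, with the shared
source replaced by the disjoint source pairs `{a,b}`, `{c,e}`): in the free box `Λ_L ⊂ ℤ³` at `β_c`, for
`a, b, c, e ∈ Λ_L` and `A ⊆ Λ_L`, the four-current gluing probability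
`P⁴ = P^{ab,∅}_{Λ_L} ⊗ P^{ce,∅}_{Λ_L}[a ↔ c in n₁+n₃+n₂+n₄]` dominates `M₁²/M₂`, where `M₁ = E⁴[N_A]`
(exactly, by the switching lemma) and `M₂ ≥ E⁴[N_A²]` (Prop. A.3) for the number `N_A` of sites of `A`
in `C_{n₁+n₃}(a) ∩ C_{n₂+n₄}(c)`, and `{N_A ≠ 0} ⊆ {a ↔ c}`; degenerate cases hold by `x/0 = 0`.
[cite: AizenmanDuminilCopinAnnals2021, §4.2 Lemma 4.4 and Appendix A Prop. A.3] -/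
theorem stub_secondMomentBox :
    ∀ (L : ℕ) (a b c e : Site 3), a ∈ box 3 L → b ∈ box 3 L → c ∈ box 3 L → e ∈ box 3 L →
      ∀ A : Finset (Site 3), A ⊆ box 3 L →
        boxMoment₁ L a b c e A ^ 2 / boxMoment₂ L a b c e A ≤ fourCurrentMeet L a b c e := by
  intro L a b c e ha hb hc he A hA
  have hP : 0 ≤ fourCurrentMeet L a b c e := measureReal_nonneg
  by_cases hdeg : boxG L a b = 0 ∨ boxG L c e = 0
  · have hM1 : boxMoment₁ L a b c e A = 0 := by
      refine Finset.sum_eq_zero fun v _ => ?_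
      rcases hdeg with h | h
      · rw [threePointRatio, h, div_zero, zero_mul]
      · rw [threePointRatio, threePointRatio, h, div_zero, mul_zero]
    rw [hM1, zero_pow two_ne_zero, zero_div]
    exact hP
  push Not at hdeg
  suffices hmain : boxMoment₁ L a b c e A ^ 2 ≤ fourCurrentMeet L a b c e * boxMoment₂ L a b c e A by
    rcases le_or_gt (boxMoment₂ L a b c e A) 0 with h0 | h0
    · rw [div_eq_mul_inv]
      exact (mul_nonpos_of_nonneg_of_nonpos (sq_nonneg _) (inv_nonpos.2 h0)).trans hP
    · exact (div_le_iff₀ h0).2 hmain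
  have hl : ∀ x ∈ box 3 L, ∃ x' : BoxVertex 3 L, (x' : Site 3) = x := fun x hx =>
    ⟨⟨x, box_subset_box_succ 3 L hx⟩, rfl⟩
  obtain ⟨⟨a', rfl⟩, ⟨b', rfl⟩, ⟨c', rfl⟩, ⟨e', rfl⟩⟩ :=
    And.intro (hl a ha) (And.intro (hl b hb) (And.intro (hl c hc) (hl e he)))
  exact boxMoment₁_sq_le L a' b' c' e' ha hb hc he A hA hdeg.1 hdeg.2

end Summit.CriticalPhenomena.Ising3DConformalLimit.Cruxes.IsingEuclidUpgradeR4NonGaussian.FreeCovarianceDeltaDichotomy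

end
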